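import Literature.NumberTheory.DiophantineGeometry.AbcDepthCensusChunked

/-!
# `DeepRegimeABC` (stmt-ABC-15121): certified census — the cell `ω₅ ≥ 9` does not meet `c ≤ 10¹⁸`, chunk runs (C)

Compute-certificate (line lead `prover-line-stmt-ABC-15121-c2-0`, 2026-08-16; human certificate
objective) for the crux `Summit.ABC.ABC.Theses.IneffectiveSubspace.DeepRegimeABC` (abc with exponent
`1 + ε` on the deep tail `{ω₅(abc) ≥ K(ε)}`, `ω₅(n) := #{p : p⁵ ∣ n}`), with the chunked soundness-proved
checker `Literature.NumberTheory.DiophantineGeometry.DepthCensus.checkCellChunk`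
(`AbcDepthCensusChunked.lean`, `depth_lt_of_checkCellChunks`).  Sharpens `…CensusDeepTailOddA.lean` (the cell
`ω₅ ≥ 9` does not meet `c ≤ 10¹⁷`) by one more decade.

**The certificate these runs serve** (assembled in `…CensusCellNine18E.lean`, registered stub
`censusCellNine18`): **the cell `{ω₅ ≥ 9}` contains no abc triple with `c ≤ 10¹⁸`** — not even a lattice
candidate `A ∣ a, B ∣ b, C ∣ a + b ≤ 10¹⁸` of any depth pattern of nine primes.  The box has `19 624 830`
depth patterns (`1.2·10⁸` outer steps); the cover is the 13-chunk cover `S₁₃` of depth 2 (as for `c₈`),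
spread over five files (chunk sizes from the independent C mirror `cert/deep_census.c` of the lead's folder):

| chunk | patterns | outer steps | run (file) |
|---|---|---|---|
| `[0]` | 222 372 | 480 204 | `n9chunk_0` (A) |
| `[1, 0]` | 174 552 | 444 820 | `n9chunk_10` (A) |
| `[2, 0]` | 174 552 | 444 820 | `n9chunk_20` (A) |
| `[3, 0]` | 174 552 | 444 820 | `n9chunk_30` (A) |
| `[1, 1]` | 1 986 406 | 12 304 568 | `n9chunk_11` (A) |
| `[1, 2]` | 2 153 264 | 13 175 084 | `n9chunk_12` (B) |
| `[1, 3]` | 2 153 264 | 13 175 084 | `n9chunk_13` (B) |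
| `[2, 1]` | 2 153 264 | 13 175 084 | `n9chunk_21` (C) |
| `[2, 2]` | 1 986 406 | 12 304 568 | `n9chunk_22` (C) |
| `[2, 3]` | 2 153 264 | 13 175 084 | `n9chunk_23` (D) |
| `[3, 1]` | 2 153 264 | 13 175 084 | `n9chunk_31` (D) |
| `[3, 2]` | 2 153 264 | 13 175 084 | `n9chunk_32` (E) |
| `[3, 3]` | 1 986 406 | 12 304 568 | `n9chunk_33` (E) |

**Certified here** (file C; files A, B, D, E hold the rest): the chunks below have no lattice candidate at all.  The only
computations trusted to the compiler are these closed `Bool` equations (`native_decide`, computational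
certificate lane).
-/

-- `Summit.<Summit>.<Problem>` is the mandated summit-side namespace (CONVENTIONS §2); for the
-- single-conjunct summit `ABC` the two coincide, so the duplicate `ABC.ABC` is deliberate.
set_option linter.dupNamespace false

namespace Summit.ABC.ABC.Theorems.DeepRegimeABC

open Literature.NumberTheory.DiophantineGeometry
open Literature.NumberTheory.DiophantineGeometry.DepthCensus

/-! ## The compiled chunk runs of this file -/

/-- Chunk `[2, 1]` of the cell `ω₅ ≥ 9` in the box `c ≤ 10¹⁸` (2 153 264 patterns, 13 175 084 outer steps): no
lattice candidate. [folklore] -/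
theorem n9chunk_21 : checkCellChunk (10 ^ 18) 3981 9 [2, 1] (fun _ _ _ => false) = true := by
  native_decide

/-- Chunk `[2, 2]` of the cell `ω₅ ≥ 9` in the box `c ≤ 10¹⁸` (1 986 406 patterns, 12 304 568 outer steps): no
lattice candidate. [folklore] -/
theorem n9chunk_22 : checkCellChunk (10 ^ 18) 3981 9 [2, 2] (fun _ _ _ => false) = true := by
  native_decide

/-! ## Registered run stub of the crux item (stmt-ABC-15121) -/

/-- **Registered run stub `censusCellNine18RunsC`** (crux `DeepRegimeABC`, line SketchIdeator5R2, human
certificate objective): the chunk runs of this file, consumed by `…CensusCellNine18E.lean`. [folklore] -/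
theorem censusCellNine18RunsC : Literature.NumberTheory.DiophantineGeometry.DepthCensus.checkCellChunk (10 ^ 18) 3981 9 [2, 1] (fun _ _ _ => false) = true ∧ Literature.NumberTheory.DiophantineGeometry.DepthCensus.checkCellChunk (10 ^ 18) 3981 9 [2, 2] (fun _ _ _ => false) = true :=
  ⟨n9chunk_21, n9chunk_22⟩

end Summit.ABC.ABC.Theorems.DeepRegimeABC
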